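import Summits.CriticalPhenomena.CardyFormulaZ2.Theses.CardySelfRefinement

/-!
# Line `tying-helps-parity` for the crux `CardySelfRefinement.CriticalPathRSW` (stmt-CriticalPhenomena-10267)

Skeleton (crux-plan, round 1, planner `planner-cruxplan-stmt-CriticalPhenomena-10267-tying-helps-parity-0`,
2026-08-16).  See the line card `Lines/tying-helps-parity.md` for the informal statements, sizes, sources,
barriers and the Disproof/triage bookkeeping.

The crux asks, for `k = 2, 3`, for a continuous path `γ : [0,1] → [0,1]²` from `(ρ,c) = (1,0)` to `(0,½)`
with both coordinates of bounded variation along which the interpolating laws `M_k(γ s)` satisfy two-sided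
box-crossing bounds with constants uniform in `s`.

THE LINE.  Certificates first, lever second.  Let `alSqProb k N v (ρ,c)` be the `M_k(ρ,c)`-probability of a
left–right crossing of the ALIGNED square of `N × N` coarse cells cornered at the coarse vertex `k • v` (lattice
drawn by `squareLatticeEmbedding.z`, mesh `√2`; side `√2·k·N`).  With thresholds `(ε₀, N₁)` the SUBCRITICAL
CERTIFICATE REGION is `V⁻ = {∃ N ≥ N₁, ∃ v, alSqProb < ε₀}`, the SUPERCRITICAL one
`V⁺ = {∃ N ≥ N₁, ∃ v, alSqProb > 1 − ε₀}`, and the certificate critical set is `K = [0,1]² ∖ (V⁻ ∪ V⁺)`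
(= `certSet k ε₀ N₁`).  Then:

* `stub_phaseDiagramAnchors` — `alSqProb` is continuous in `(ρ,c)` (a polynomial of the clamped parameters) and
  monotone in `c`; the bottom edge `c = 0` is never supercritically certified, the level `c = 9/10` never
  subcritically; `(1,0)` (= bond-`kℤ²` at `½`) and `(0,½)` (= bond-`ℤ²` at `½`) carry two-sided square bounds.
  ⇒ `V∓` open, fibres of `V⁻` down-sets and of `V⁺` up-sets in `c`, endpoints in `K`.
* `stub_finiteSizeCriterion` — the two certificates never fire at the same parameter (k-dependent planar
  finite-size criteria, primal and dual) ⇒ `V⁻ ∩ V⁺ = ∅`, so every fibre `K_ρ` is a non-empty closed interval.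
* `stub_tyingHelps` — THE LEVER ("tying helps when the interior is sparse"): for `c ≤ c₀(k)` the square-crossing
  probability is non-decreasing in the tying parameter `ρ` ⇒ `V⁻ ∩ {c ≤ c₀}` is a down-set in `ρ` ⇒ the lower
  envelope `c⁻(ρ) = sup V⁻_ρ` is non-increasing wherever `c⁻ ≤ c₀` — exactly the neighbourhood of the degenerate
  corner `(1,0)` where every cone constant blows up.
* `stub_interiorPrices` — the integrated Aizenman–Grimmett cone on `c ∈ [c_lo, 9/10]`:
  `alSqProb(ρ,c) ≤ alSqProb(ρ', c + L|ρ−ρ'|)` ⇒ `V⁻` is invariant under the flow `(ρ,c) ↦ (ρ', c − L|ρ−ρ'|)` above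
  `c_lo` ⇒ `c⁻` is `L`-Lipschitz wherever `c⁻ ≥ c_lo`.
* `stub_envelopePath` — pure real analysis: open `V∓ ⊆ ℝ²` with those order/flow properties (`0 < c_lo < c₀`)
  admit a continuous path with BV coordinates inside `[0,1]² ∖ (V⁻ ∪ V⁺)` from `(1,0)` to `(0,½)` (the completed
  graph of the lower envelope: Lipschitz-where-high + antitone-where-low ⇒ BV; jumps bridged inside the interval
  fibres; closedness of `K` keeps one-sided limits in `K`).
* `stub_squareBoundsGiveRSW` — Köhler-Schindler–Tassion: two-sided aligned-square bounds at all scales `≥ N₁`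
  give box-crossing bounds at every aspect ratio and translation with constants depending on `(k, ε₀, N₁, a)`
  only ⇒ uniformity in `s`.

`CriticalPathRSW_of` composes the six registered stubs into the crux BY NAME with no `sorry`
(choices: `ε₀ = min ε₁ ε`, `N₁ = max of the four thresholds`, `c₀' = min c₀ ½`, `c_lo = c₀'/2`).

Disproof used (names known from the standing disprover's attach notes; the file body is not mounted in this
jail): no `_false_without_` theorem exists for this crux; `exists_noCont_iff_endpoints` (continuity is the whole
content) is honoured — continuity is PRODUCED by `stub_envelopePath` from the two flows, never assumed; the stub
set targets the disprover's sufficient shape `criticalPathRSW_of_antitone_criticalCurves` /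
`pathOK_of_lipschitz_antitone_criticalCurve` but WITHOUT continuity or sharpness of a critical curve (jumps of the
envelope are bridged in the interval fibres); `allOpen_strictMono` / `someOpen_strictAnti` (no stochastic order
in `ρ`) are respected — `stub_tyingHelps` compares crossing probabilities at small `c` only, never laws;
`coarseTransmissivity_lt_half` is the mechanism behind anchor (c).  No `Theorems/CriticalPathRSW/Negative/` lemma
has landed (nothing to import).
-/

noncomputable section

namespace Summit.CriticalPhenomena.CardyFormulaZ2.Cruxes.CriticalPathRSW.TyingHelpsParity

open MeasureTheory Set
open Literature.Probability.LatticeModels (Site prodBernoulli BoxCrossingBounds squareLatticeEmbedding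
  embRectCrossing)
open Literature.Probability.Percolation (BondConfig half)

/-! ## The model, verbatim from the crux (`criticalPathRSW_iff` is `Iff.rfl`) -/

/-- Axial sub-edge predicate: the edge from `v` in direction `d` lies on a coarse line of `kℤ²`
(verbatim `ax` of the crux; reducible, as the definitional restatement requires). -/
abbrev ax : ℕ → Site 2 × Fin 2 → Prop := fun k e => (k : ℤ) ∣ e.1 (if e.2 = 0 then 1 else 0)

/-- The bundle (coarse edge) label of an axial sub-edge (verbatim `tb`). -/
abbrev tb : ℕ → Site 2 × Fin 2 → Site 2 := fun k e i => e.1 i / (k : ℤ)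

/-- Open-ness of the edge `(v,d)` read from the coin set `S` (verbatim `opn`): axial sub-edges follow the
shared bundle coin when the bundle selector is on, their individual coin otherwise; interior edges follow
their individual coin. -/
abbrev opn : ℕ → Set (Site 2 × Fin 2 × Fin 3) → Site 2 × Fin 2 → Prop := fun k S e =>
  if ax k e then ((tb k e, e.2, (2 : Fin 3)) ∈ S ∧ (tb k e, e.2, (1 : Fin 3)) ∈ S) ∨
    ((tb k e, e.2, (2 : Fin 3)) ∉ S ∧ (e.1, e.2, (0 : Fin 3)) ∈ S)
  else (e.1, e.2, (0 : Fin 3)) ∈ S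

/-- The bond configuration defined by a coin set (verbatim `cfg`). -/
abbrev cfg : ℕ → Set (Site 2 × Fin 2 × Fin 3) → BondConfig (Site 2) := fun k S =>
  {e | ∃ (v : Site 2) (d : Fin 2), e = s(v, v + (if d = 0 then ![1, 0] else ![0, 1])) ∧ opn k S (v, d)}

/-- Coin biases (verbatim `prm`): individual coins of interior edges `c`, of axial sub-edges `½`; shared
bundle coins `½`; selectors `ρ` (parameters clamped to `[0,1]` by `projIcc`). -/
abbrev prm : ℕ → ℝ → ℝ → Site 2 × Fin 2 × Fin 3 → unitInterval := fun k ρ c i =>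
  if i.2.2 = 0 then (if ax k (i.1, i.2.1) then half else Set.projIcc (0 : ℝ) 1 zero_le_one c)
  else if i.2.2 = 1 then half else Set.projIcc (0 : ℝ) 1 zero_le_one ρ

/-- The interpolating law `M_k(ρ,c)` on bond configurations of `ℤ²` (verbatim `M`). -/
abbrev M : ℕ → ℝ → ℝ → Measure (BondConfig (Site 2)) := fun k ρ c => (prodBernoulli (prm k ρ c)).map (cfg k)

/-- `PathOK k γ` (verbatim from the crux). -/
abbrev PathOK : ℕ → (unitInterval → ℝ × ℝ) → Prop := fun k γ =>
  Continuous γ ∧ γ 0 = (1, 0) ∧ γ 1 = (0, 1 / 2) ∧ (∀ s, γ s ∈ Set.Icc (0 : ℝ) 1 ×ˢ Set.Icc (0 : ℝ) 1) ∧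
  BoundedVariationOn (fun s => (γ s).1) Set.univ ∧ BoundedVariationOn (fun s => (γ s).2) Set.univ ∧
  ∀ a : ℝ, 0 < a → ∃ c₀ > 0, ∃ n₀ : ℕ, ∀ s, BoxCrossingBounds (M k (γ s).1 (γ s).2) squareLatticeEmbedding.z a c₀ n₀

/-- The crux, definitionally: `CriticalPathRSW ↔ ∀ k ∈ {2,3}, ∃ γ, PathOK k γ`. -/
theorem criticalPathRSW_iff :
    Summit.CriticalPhenomena.CardyFormulaZ2.Theses.CardySelfRefinement.CriticalPathRSW ↔
      ∀ k : ℕ, k = 2 ∨ k = 3 → ∃ γ : unitInterval → ℝ × ℝ, PathOK k γ := Iff.rfl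

/-! ## The certificate events: ALIGNED coarse squares -/

/-- `alSqProb k N v q`: the `M_k(q.1, q.2)`-probability of a left–right open crossing of the ALIGNED square of
`N × N` coarse cells with lower-left corner at the coarse vertex `k • v` — the `embRectCrossing` event (as in
`BoxCrossingBounds`, slack `2`) of the drawing translated by `z (k • v)`, side `√2·k·N` (the embedding
`squareLatticeEmbedding.z` has mesh `√2`).  Alignment (all four sides on coarse lines of `kℤ²`) is what makes the
lever `TyingHelps` a bundle-by-bundle statement (triage r1-1/r1-3 sharpening): a crossing can neither start nor
end at an interior vertex of a bundle without that being redundant. -/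
def alSqProb (k : ℕ) (N : ℕ) (v : Site 2) (q : ℝ × ℝ) : ℝ :=
  (M k q.1 q.2).real (embRectCrossing
    (fun x => squareLatticeEmbedding.z x - squareLatticeEmbedding.z (k • v))
    (Real.sqrt 2 * k * N) (Real.sqrt 2 * k * N))

/-- The certificate critical set `K = certSet k ε₀ N₁`: parameters in the unit square at which EVERY aligned
square of `N ≥ N₁` coarse cells, at every coarse translation, is crossed with probability in `[ε₀, 1 − ε₀]`
(neither finite-size certificate fires). -/
def certSet (k : ℕ) (ε₀ : ℝ) (N₁ : ℕ) : Set (ℝ × ℝ) :=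
  {q | q ∈ Icc (0 : ℝ) 1 ×ˢ Icc (0 : ℝ) 1 ∧
    ∀ N : ℕ, N₁ ≤ N → ∀ v : Site 2, ε₀ ≤ alSqProb k N v q ∧ alSqProb k N v q ≤ 1 - ε₀}

/-! ## The six stub STATEMENTS (named `Prop`s; the registered `stub_*` theorems below restate them verbatim and
`Registered.stub_*` are the name-keyed aliases used as the hypotheses of `CriticalPathRSW_of`) -/

/-- STUB 1 statement — TYING HELPS WHEN THE INTERIOR IS SPARSE (the lever).  There are `c₀ > 0` and a scale
`N₀` such that for every aligned square of `N ≥ N₀` coarse cells, every coarse translation `v` and every interior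
density `c ≤ c₀`, the crossing probability is non-decreasing in the tying parameter `ρ` (all real `ρ`, `c`: the law clamps its
parameters to `[0,1]`). -/
def TyingHelps (k : ℕ) : Prop :=
  ∃ c₀ : ℝ, 0 < c₀ ∧ ∃ N₀ : ℕ, ∀ N : ℕ, N₀ ≤ N → ∀ (v : Site 2) (c : ℝ), c ≤ c₀ →
    ∀ ρ₁ ρ₂ : ℝ, ρ₁ ≤ ρ₂ → alSqProb k N v (ρ₁, c) ≤ alSqProb k N v (ρ₂, c)

/-- STUB 2 statement — INTERIOR EDGES PRICE EVERY `ρ`-MOVE (integrated Aizenman–Grimmett cone away from `c = 0`):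
for every `c_lo ∈ (0, 9/10)` there are `L ≥ 0` and `N₀` such that on aligned squares of `N ≥ N₀` coarse cells any
change of `ρ` is dominated by raising `c` by `L·|Δρ|`, as long as `c` stays in `[c_lo, 9/10]`. -/
def InteriorPrices (k : ℕ) : Prop :=
  ∀ clo : ℝ, 0 < clo → clo < 9 / 10 → ∃ L : ℝ, 0 ≤ L ∧ ∃ N₀ : ℕ, ∀ N : ℕ, N₀ ≤ N →
    ∀ (v : Site 2) (ρ ρ' c : ℝ), clo ≤ c → c + L * |ρ - ρ'| ≤ 9 / 10 →
      alSqProb k N v (ρ, c) ≤ alSqProb k N v (ρ', c + L * |ρ - ρ'|)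

/-- STUB 3 statement — FINITE-SIZE CRITERION (k-dependent, planar, primal and dual): there are `ε₁ > 0` and
`N₂` such that at NO parameter can one aligned square of `≥ N₂` cells be crossed with probability `< ε₁` while
another aligned square of `≥ N₂` cells is crossed with probability `> 1 − ε₁`. -/
def FiniteSizeCriterion (k : ℕ) : Prop :=
  ∃ ε₁ : ℝ, 0 < ε₁ ∧ ∃ N₂ : ℕ, ∀ (q : ℝ × ℝ) (N N' : ℕ), N₂ ≤ N → N₂ ≤ N' → ∀ v v' : Site 2,
    alSqProb k N v q < ε₁ → alSqProb k N' v' q ≤ 1 - ε₁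

/-- STUB 4 statement — PHASE-DIAGRAM ANCHORS: (a) `alSqProb k N v` is continuous on `ℝ²`; (b) non-decreasing in
`c`; and there are `ε > 0`, `N₀` with, for all `N ≥ N₀` and `v`: (c) the bottom edge `c = 0` has square
crossings `≤ 1 − ε`; (d) the level `c = 9/10` has square crossings `≥ ε`; (e) `(1,0)` has them `≥ ε`;
(f) `(0,½)` has them in `[ε, 1 − ε]`. -/
def PhaseDiagramAnchors (k : ℕ) : Prop :=
  (∀ (N : ℕ) (v : Site 2), Continuous (alSqProb k N v)) ∧
  (∀ (N : ℕ) (v : Site 2) (ρ : ℝ), Monotone (fun c : ℝ => alSqProb k N v (ρ, c))) ∧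
  ∃ ε : ℝ, 0 < ε ∧ ∃ N₀ : ℕ, ∀ N : ℕ, N₀ ≤ N → ∀ v : Site 2,
    (∀ ρ : ℝ, alSqProb k N v (ρ, 0) ≤ 1 - ε) ∧
    (∀ ρ : ℝ, ε ≤ alSqProb k N v (ρ, 9 / 10)) ∧
    ε ≤ alSqProb k N v (1, 0) ∧
    (ε ≤ alSqProb k N v (0, 1 / 2) ∧ alSqProb k N v (0, 1 / 2) ≤ 1 - ε)

/-- STUB 5 statement — SQUARE BOUNDS GIVE RSW, UNIFORMLY (Köhler-Schindler–Tassion for the `kℤ² ⋊ D₄`-invariant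
positively associated laws `M_k` and their planar duals): two-sided bounds `[ε₀, 1 − ε₀]` for aligned squares at all
scales `N ≥ N₁` and all coarse translations imply box-crossing bounds at every aspect ratio `a` (all real
translations `w`, all `n ≥ n₀`), with constants depending on `(k, ε₀, N₁, a)` only — i.e. uniformly on
`certSet k ε₀ N₁`. -/
def SquareBoundsGiveRSW (k : ℕ) : Prop :=
  ∀ ε₀ : ℝ, 0 < ε₀ → ∀ (N₁ : ℕ) (a : ℝ), 0 < a → ∃ c₀ > 0, ∃ n₀ : ℕ, ∀ q ∈ certSet k ε₀ N₁,
    BoxCrossingBounds (M k q.1 q.2) squareLatticeEmbedding.z a c₀ n₀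

/-- STUB 6 statement — THE ENVELOPE PATH LEMMA (pure real analysis in the unit square, no percolation).  Open
sets `V⁻, V⁺ ⊆ ℝ²` ("certified subcritical", "certified supercritical"), `V⁻` a down-set and `V⁺` an up-set in the second
coordinate, disjoint, with the boundary data `[0,1]×{0} ∩ V⁺ = ∅`, `[0,1]×{1} ∩ V⁻ = ∅`, `(1,0) ∉ V⁻`,
`(0,½) ∉ V⁻ ∪ V⁺`, and the two flows — `V⁻ ∩ {c ≤ c₀}` is a down-set in `ρ ∈ [0,1]` (tying helps) and `V⁻`
is invariant under `(ρ,c) ↦ (ρ', c − L|ρ−ρ'|)` above `c_lo` (the cone), `0 < c_lo < c₀`, `0 ≤ L` — admit a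
continuous path with BV coordinates in `[0,1]² ∖ (V⁻ ∪ V⁺)` from `(1,0)` to `(0,½)`.  (Proof idea: the lower
envelope `g(ρ) = sup V⁻_ρ` is antitone where `g ≤ c₀` and `L`-Lipschitz where `g ≥ c_lo`, hence BV; its
completed graph — vertical segments across jumps and at the two ends — lies in the closed set `K`, whose fibres
are intervals.) -/
def EnvelopePathLemma : Prop :=
  ∀ (Vm Vp : Set (ℝ × ℝ)) (c₀ clo L : ℝ),
    IsOpen Vm → IsOpen Vp →
    (∀ ρ c c' : ℝ, c' ≤ c → (ρ, c) ∈ Vm → (ρ, c') ∈ Vm) →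
    (∀ ρ c c' : ℝ, c ≤ c' → (ρ, c) ∈ Vp → (ρ, c') ∈ Vp) →
    Disjoint Vm Vp →
    (∀ ρ ∈ Icc (0 : ℝ) 1, (ρ, (0 : ℝ)) ∉ Vp) →
    (∀ ρ ∈ Icc (0 : ℝ) 1, (ρ, (1 : ℝ)) ∉ Vm) →
    ((1 : ℝ), (0 : ℝ)) ∉ Vm →
    ((0 : ℝ), (1 / 2 : ℝ)) ∉ Vm → ((0 : ℝ), (1 / 2 : ℝ)) ∉ Vp →
    0 < clo → clo < c₀ → 0 ≤ L →
    (∀ ρ₁ ρ₂ c : ℝ, 0 ≤ ρ₁ → ρ₁ ≤ ρ₂ → ρ₂ ≤ 1 → c ≤ c₀ → (ρ₂, c) ∈ Vm → (ρ₁, c) ∈ Vm) →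
    (∀ ρ ρ' c : ℝ, ρ ∈ Icc (0 : ℝ) 1 → ρ' ∈ Icc (0 : ℝ) 1 → (ρ, c) ∈ Vm →
        clo ≤ c - L * |ρ - ρ'| → (ρ', c - L * |ρ - ρ'|) ∈ Vm) →
    ∃ γ : unitInterval → ℝ × ℝ, Continuous γ ∧ γ 0 = (1, 0) ∧ γ 1 = (0, 1 / 2) ∧
      (∀ s, γ s ∈ Icc (0 : ℝ) 1 ×ˢ Icc (0 : ℝ) 1) ∧
      BoundedVariationOn (fun s => (γ s).1) univ ∧ BoundedVariationOn (fun s => (γ s).2) univ ∧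
      ∀ s, γ s ∉ Vm ∧ γ s ∉ Vp

/-! ## The registered stubs (`sorry` lives only in these six theorems) -/

/-- **STUB 1 · `stub_tyingHelps`** (the LEVER; size L; new).  For `k = 2, 3`: `∃ c₀ > 0, ∃ n₀, ∀ n ≥ n₀, ∀ w,
∀ c ≤ c₀`, `ρ ↦ alSqProb k N v (ρ, c)` is monotone.  Mechanism: bundle by bundle the signed Russo weight of the
up-set class `A_E` is `½[1…1 ∈ A] + ½[0…0 ∈ A] − |A|/2^k`; a negative class forces an interior vertex of the
bundle to do connecting work through an OPEN interior edge (k = 2: the unique negative class `{01,10,11}`;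
k = 3: atom-containing classes of size ≥ 5 — kernel-checked by triager 3), which costs a factor `O(c)` against the
positive series class after a ρ-uniform local surgery; so each bundle contributes `≥ 0` for `c ≤ c₀(k)`.  Exact
transfer-matrix data (triager 1, j012294): `∂ρP > 0` at every grid point with `c ≤ 0.85` on all boxes up to
12×6 (k = 2) / 12×3, 6×6 (k = 3). -/
theorem stub_tyingHelps : ∀ k : ℕ, k = 2 ∨ k = 3 →
    ∃ c₀ : ℝ, 0 < c₀ ∧ ∃ N₀ : ℕ, ∀ N : ℕ, N₀ ≤ N → ∀ (v : Site 2) (c : ℝ), c ≤ c₀ →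
      ∀ ρ₁ ρ₂ : ℝ, ρ₁ ≤ ρ₂ → alSqProb k N v (ρ₁, c) ≤ alSqProb k N v (ρ₂, c) := by
  sorry

/-- **STUB 2 · `stub_interiorPrices`** (size M/L; Aizenman–Grimmett / Grimmett (3.17) bookkeeping, bond case per
Balister–Bollobás–Riordan).  For `k = 2, 3` and `c_lo ∈ (0, 9/10)`: `∃ L ≥ 0, ∃ N₀, ∀ N ≥ N₀, ∀ v ρ ρ' c`,
`c_lo ≤ c → c + L|ρ−ρ'| ≤ 9/10 → alSqProb(ρ,c) ≤ alSqProb(ρ', c + L|ρ−ρ'|)`.  It is the integral, along the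
segment from `(ρ,c)` to `(ρ', c + L|ρ−ρ'|)`, of the differential cone `|∂ρP| ≤ L ∂cP` on `[0,1]×[c_lo, 9/10]`:
every bundle-sensitive configuration is turned, by a bounded local surgery using CONSTANT bundle states only
(mass ≥ 2^{-k} whatever ρ) and `O(k)` priced interior edges (each of probability in `[c_lo, 9/10]`), into one
where a designated interior edge is pivotal. -/
theorem stub_interiorPrices : ∀ k : ℕ, k = 2 ∨ k = 3 →
    ∀ clo : ℝ, 0 < clo → clo < 9 / 10 → ∃ L : ℝ, 0 ≤ L ∧ ∃ N₀ : ℕ, ∀ N : ℕ, N₀ ≤ N →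
      ∀ (v : Site 2) (ρ ρ' c : ℝ), clo ≤ c → c + L * |ρ - ρ'| ≤ 9 / 10 →
        alSqProb k N v (ρ, c) ≤ alSqProb k N v (ρ', c + L * |ρ - ρ'|) := by
  sorry

/-- **STUB 3 · `stub_finiteSizeCriterion`** (size L; Kesten 1982 Thm 5.1 / Cor 5.1 block argument for a
k-dependent planar law, primal and dual).  For `k = 2, 3`: `∃ ε₁ > 0, ∃ n₂` such that
`alSqProb k N v q < ε₁` with `n ≥ n₂` (⇒ hard-way `2n × n` crossing `< ε₁` ⇒ exponential decay of primal
connections ⇒ all large squares crossed with probability → 0) is incompatible with `alSqProb k N' v' q > 1 − ε₁`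
with `n' ≥ n₂` (⇒ dual decay ⇒ squares crossed with probability → 1). -/
theorem stub_finiteSizeCriterion : ∀ k : ℕ, k = 2 ∨ k = 3 →
    ∃ ε₁ : ℝ, 0 < ε₁ ∧ ∃ N₂ : ℕ, ∀ (q : ℝ × ℝ) (N N' : ℕ), N₂ ≤ N → N₂ ≤ N' → ∀ v v' : Site 2,
      alSqProb k N v q < ε₁ → alSqProb k N' v' q ≤ 1 - ε₁ := by
  sorry

/-- **STUB 4 · `stub_phaseDiagramAnchors`** (size M/L; elementary but Lean-laborious).  For `k = 2, 3`:
(a) continuity of `q ↦ alSqProb k N v q` (finitely many coins matter: a polynomial in the clamped parameters);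
(b) monotonicity in `c` (monotone coupling of the interior coins); (c) `alSqProb(ρ,0) ≤ 1 − ε`: at `c = 0` a
crossing of an ALIGNED square is a crossing of the `N × N` coarse box by fully open bundles, i.e. Bernoulli
(`ρ/2 + (1−ρ)2^{-k} ≤ ½`) bond percolation on `kℤ²` (`coarseTransmissivity_lt_half`), dominated by the critical
one, whose boxes are crossed with probability `≤ 1 − ε` (RSW, `square_boxCrossing_holds`);
(d) `alSqProb(ρ, 9/10) ≥ ε`: the interior edges alone contain a `k`-subdivided square lattice of edge-weight
`(9/10)^k > 2/3`, supercritical by a Peierls count; (e) `(1,0)` is bond-`kℤ²` at `½` and (f) `(0,½)` is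
bond-`ℤ²` at `½`: RSW square bounds (`square_boxCrossing_holds`, cf. the route's support item ExactEndpoints). -/
theorem stub_phaseDiagramAnchors : ∀ k : ℕ, k = 2 ∨ k = 3 →
    (∀ (N : ℕ) (v : Site 2), Continuous (alSqProb k N v)) ∧
    (∀ (N : ℕ) (v : Site 2) (ρ : ℝ), Monotone (fun c : ℝ => alSqProb k N v (ρ, c))) ∧
    ∃ ε : ℝ, 0 < ε ∧ ∃ N₀ : ℕ, ∀ N : ℕ, N₀ ≤ N → ∀ v : Site 2,
      (∀ ρ : ℝ, alSqProb k N v (ρ, 0) ≤ 1 - ε) ∧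
      (∀ ρ : ℝ, ε ≤ alSqProb k N v (ρ, 9 / 10)) ∧
      ε ≤ alSqProb k N v (1, 0) ∧
      (ε ≤ alSqProb k N v (0, 1 / 2) ∧ alSqProb k N v (0, 1 / 2) ≤ 1 - ε) := by
  sorry

/-- **STUB 5 · `stub_squareBoundsGiveRSW`** (size XL; the published engine: Köhler-Schindler–Tassion,
arXiv:2011.04618 Thm 1 — hard-way ≥ ψ_ρ(easy-way) at the same scale, universal homeomorphism — in the
"robust" form of their Comment 1 for the `kℤ² ⋊ D₄`-invariant FKG laws `M_k` and their duals, plus planar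
duality and FKG gluing).  For `k = 2, 3`: aligned-square bounds `[ε₀, 1 − ε₀]` at all scales `N ≥ N₁` and coarse
translations ⇒ `BoxCrossingBounds` at every aspect ratio (all real translations) with constants `(c₀, n₀)`
depending on `(k, ε₀, N₁, a)` only (`kℤ²`-periodicity moves coarse translates to arbitrary ones up to one cell
of slack, absorbed by the aspect-ratio robustness of KST). -/
theorem stub_squareBoundsGiveRSW : ∀ k : ℕ, k = 2 ∨ k = 3 →
    ∀ ε₀ : ℝ, 0 < ε₀ → ∀ (N₁ : ℕ) (a : ℝ), 0 < a → ∃ c₀ > 0, ∃ n₀ : ℕ, ∀ q ∈ certSet k ε₀ N₁,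
      BoxCrossingBounds (M k q.1 q.2) squareLatticeEmbedding.z a c₀ n₀ := by
  sorry

/-- **STUB 6 · `stub_envelopePath`** (size M/L; pure real analysis, `k`-free) — the envelope path lemma
`EnvelopePathLemma` verbatim: see its docstring. -/
theorem stub_envelopePath : ∀ (Vm Vp : Set (ℝ × ℝ)) (c₀ clo L : ℝ),
    IsOpen Vm → IsOpen Vp →
    (∀ ρ c c' : ℝ, c' ≤ c → (ρ, c) ∈ Vm → (ρ, c') ∈ Vm) →
    (∀ ρ c c' : ℝ, c ≤ c' → (ρ, c) ∈ Vp → (ρ, c') ∈ Vp) →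
    Disjoint Vm Vp →
    (∀ ρ ∈ Icc (0 : ℝ) 1, (ρ, (0 : ℝ)) ∉ Vp) →
    (∀ ρ ∈ Icc (0 : ℝ) 1, (ρ, (1 : ℝ)) ∉ Vm) →
    ((1 : ℝ), (0 : ℝ)) ∉ Vm →
    ((0 : ℝ), (1 / 2 : ℝ)) ∉ Vm → ((0 : ℝ), (1 / 2 : ℝ)) ∉ Vp →
    0 < clo → clo < c₀ → 0 ≤ L →
    (∀ ρ₁ ρ₂ c : ℝ, 0 ≤ ρ₁ → ρ₁ ≤ ρ₂ → ρ₂ ≤ 1 → c ≤ c₀ → (ρ₂, c) ∈ Vm → (ρ₁, c) ∈ Vm) →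
    (∀ ρ ρ' c : ℝ, ρ ∈ Icc (0 : ℝ) 1 → ρ' ∈ Icc (0 : ℝ) 1 → (ρ, c) ∈ Vm →
        clo ≤ c - L * |ρ - ρ'| → (ρ', c - L * |ρ - ρ'|) ∈ Vm) →
    ∃ γ : unitInterval → ℝ × ℝ, Continuous γ ∧ γ 0 = (1, 0) ∧ γ 1 = (0, 1 / 2) ∧
      (∀ s, γ s ∈ Icc (0 : ℝ) 1 ×ˢ Icc (0 : ℝ) 1) ∧
      BoundedVariationOn (fun s => (γ s).1) univ ∧ BoundedVariationOn (fun s => (γ s).2) univ ∧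
      ∀ s, γ s ∉ Vm ∧ γ s ∉ Vp := by
  sorry

/-! ### Consistency: each named statement IS its registered stub (definitionally) -/

theorem tyingHelps_holds : ∀ k, k = 2 ∨ k = 3 → TyingHelps k := stub_tyingHelps
theorem interiorPrices_holds : ∀ k, k = 2 ∨ k = 3 → InteriorPrices k := stub_interiorPrices
theorem finiteSizeCriterion_holds : ∀ k, k = 2 ∨ k = 3 → FiniteSizeCriterion k := stub_finiteSizeCriterion
theorem phaseDiagramAnchors_holds : ∀ k, k = 2 ∨ k = 3 → PhaseDiagramAnchors k := stub_phaseDiagramAnchors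
theorem squareBoundsGiveRSW_holds : ∀ k, k = 2 ∨ k = 3 → SquareBoundsGiveRSW k := stub_squareBoundsGiveRSW
theorem envelopePathLemma_holds : EnvelopePathLemma := stub_envelopePath

/-! ### Name-keyed aliases of the six statements (the hypotheses of the composition) -/
namespace Registered

/-- Alias of `∀ k ∈ {2,3}, TyingHelps k`, keyed by the registered stub name. -/
abbrev stub_tyingHelps : Prop := ∀ k : ℕ, k = 2 ∨ k = 3 → TyingHelps k
/-- Alias of `∀ k ∈ {2,3}, InteriorPrices k`. -/
abbrev stub_interiorPrices : Prop := ∀ k : ℕ, k = 2 ∨ k = 3 → InteriorPrices k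
/-- Alias of `∀ k ∈ {2,3}, FiniteSizeCriterion k`. -/
abbrev stub_finiteSizeCriterion : Prop := ∀ k : ℕ, k = 2 ∨ k = 3 → FiniteSizeCriterion k
/-- Alias of `∀ k ∈ {2,3}, PhaseDiagramAnchors k`. -/
abbrev stub_phaseDiagramAnchors : Prop := ∀ k : ℕ, k = 2 ∨ k = 3 → PhaseDiagramAnchors k
/-- Alias of `∀ k ∈ {2,3}, SquareBoundsGiveRSW k`. -/
abbrev stub_squareBoundsGiveRSW : Prop := ∀ k : ℕ, k = 2 ∨ k = 3 → SquareBoundsGiveRSW k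
/-- Alias of `EnvelopePathLemma`. -/
abbrev stub_envelopePath : Prop := EnvelopePathLemma

end Registered

/-! ## The composition: the six stubs imply the crux BY NAME (kernel-checked; no `sorry` below this line) -/

/-- **`CriticalPathRSW_of`** — for `k = 2, 3`: thresholds `ε₀ := min ε₁ ε`, `n₁ :=` the max of the four scale
thresholds, `c₀' := min c₀ ½`, `c_lo := c₀'/2`; the certificate regions `V⁻ = {∃ n ≥ n₁, ∃ w, alSqProb k n w < ε₀}`,
`V⁺ = {∃ n ≥ n₁, ∃ w, alSqProb k n w > 1 − ε₀}` (`n` coarse cells, `w : Site 2` a coarse offset) satisfy the fifteen hypotheses of the envelope path lemma (openness and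
fibre monotonicity from the anchors (a),(b); disjointness from the finite-size criterion; boundary data from the
anchors (c)–(f); the two flows from `TyingHelps` and `InteriorPrices`, the latter applicable because `V⁻` lies
below `c = 9/10` by anchor (d)); the resulting path lies in `certSet k ε₀ n₁`, on which `SquareBoundsGiveRSW`
gives the uniform box-crossing bounds. -/
theorem CriticalPathRSW_of (h1 : Registered.stub_tyingHelps) (h2 : Registered.stub_interiorPrices)
    (h3 : Registered.stub_finiteSizeCriterion) (h4 : Registered.stub_phaseDiagramAnchors)
    (h5 : Registered.stub_squareBoundsGiveRSW) (h6 : Registered.stub_envelopePath) :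
    Summit.CriticalPhenomena.CardyFormulaZ2.Theses.CardySelfRefinement.CriticalPathRSW := by
  rw [criticalPathRSW_iff]
  intro k hk
  -- the six inputs at this `k`
  obtain ⟨c₀, hc₀, m₁, hT⟩ := h1 k hk
  obtain ⟨ε₁, hε₁, m₃, hFS⟩ := h3 k hk
  obtain ⟨hcont, hmono, ε, hε, m₄, hA⟩ := h4 k hk
  -- shrink `c₀` to `c₀' ≤ 1/2` and fix `c_lo := c₀'/2 < 9/10`
  set c₀' : ℝ := min c₀ (1 / 2) with hc₀'_def
  have hc₀' : 0 < c₀' := lt_min hc₀ (by norm_num)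
  have hc₀'le : c₀' ≤ c₀ := min_le_left _ _
  have hc₀'half : c₀' ≤ 1 / 2 := min_le_right _ _
  have hclo : 0 < c₀' / 2 := by positivity
  have hclo9 : c₀' / 2 < 9 / 10 := by linarith
  obtain ⟨L, hL, m₂, hC⟩ := h2 k hk (c₀' / 2) hclo hclo9
  -- thresholds
  set ε₀ : ℝ := min ε₁ ε with hε₀_def
  have hε₀ : 0 < ε₀ := lt_min hε₁ hε
  have hε₀₁ : ε₀ ≤ ε₁ := min_le_left _ _
  have hε₀₄ : ε₀ ≤ ε := min_le_right _ _
  set n₁ : ℕ := max (max m₁ m₂) (max m₃ m₄) with hn₁_def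
  have hn₁₁ : m₁ ≤ n₁ := le_trans (le_max_left _ _) (le_max_left _ _)
  have hn₁₂ : m₂ ≤ n₁ := le_trans (le_max_right _ _) (le_max_left _ _)
  have hn₁₃ : m₃ ≤ n₁ := le_trans (le_max_left _ _) (le_max_right _ _)
  have hn₁₄ : m₄ ≤ n₁ := le_trans (le_max_right _ _) (le_max_right _ _)
  -- the certificate regions
  set Vm : Set (ℝ × ℝ) := {q | ∃ n : ℕ, n₁ ≤ n ∧ ∃ w : Site 2, alSqProb k n w q < ε₀} with hVm_def
  set Vp : Set (ℝ × ℝ) := {q | ∃ n : ℕ, n₁ ≤ n ∧ ∃ w : Site 2, 1 - ε₀ < alSqProb k n w q} with hVp_def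
  -- (1,2) openness
  have hVm_open : IsOpen Vm := by
    have hrepr : Vm = ⋃ n : ℕ, ⋃ (_ : n₁ ≤ n), ⋃ w : Site 2, alSqProb k n w ⁻¹' Iio ε₀ := by
      ext q
      simp only [hVm_def, mem_setOf_eq, mem_iUnion, mem_preimage, mem_Iio, exists_prop]
    rw [hrepr]
    exact isOpen_iUnion fun n => isOpen_iUnion fun _ => isOpen_iUnion fun w =>
      (hcont n w).isOpen_preimage _ isOpen_Iio
  have hVp_open : IsOpen Vp := by
    have hrepr : Vp = ⋃ n : ℕ, ⋃ (_ : n₁ ≤ n), ⋃ w : Site 2, alSqProb k n w ⁻¹' Ioi (1 - ε₀) := by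
      ext q
      simp only [hVp_def, mem_setOf_eq, mem_iUnion, mem_preimage, mem_Ioi, exists_prop]
    rw [hrepr]
    exact isOpen_iUnion fun n => isOpen_iUnion fun _ => isOpen_iUnion fun w =>
      (hcont n w).isOpen_preimage _ isOpen_Ioi
  -- (3,4) fibre monotonicity
  have hVm_down : ∀ ρ c c' : ℝ, c' ≤ c → (ρ, c) ∈ Vm → (ρ, c') ∈ Vm := by
    rintro ρ c c' hcc ⟨n, hn, w, hw⟩
    exact ⟨n, hn, w, lt_of_le_of_lt (hmono n w ρ hcc) hw⟩
  have hVp_up : ∀ ρ c c' : ℝ, c ≤ c' → (ρ, c) ∈ Vp → (ρ, c') ∈ Vp := by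
    rintro ρ c c' hcc ⟨n, hn, w, hw⟩
    exact ⟨n, hn, w, lt_of_lt_of_le hw (hmono n w ρ hcc)⟩
  -- (5) disjointness = the finite-size criterion
  have hdisj : Disjoint Vm Vp := by
    rw [Set.disjoint_left]
    rintro q ⟨n, hn, w, hw⟩ ⟨n', hn', w', hw'⟩
    have h := hFS q n n' (le_trans hn₁₃ hn) (le_trans hn₁₃ hn') w w' (lt_of_lt_of_le hw hε₀₁)
    linarith
  -- (6)-(10) boundary data from the anchors
  have hbot : ∀ ρ ∈ Icc (0 : ℝ) 1, (ρ, (0 : ℝ)) ∉ Vp := by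
    rintro ρ - ⟨n, hn, w, hw⟩
    have h := (hA n (le_trans hn₁₄ hn) w).1 ρ
    linarith
  have hlevel : ∀ ρ : ℝ, (ρ, (9 / 10 : ℝ)) ∉ Vm := by
    rintro ρ ⟨n, hn, w, hw⟩
    have h := (hA n (le_trans hn₁₄ hn) w).2.1 ρ
    linarith
  have htop : ∀ ρ ∈ Icc (0 : ℝ) 1, (ρ, (1 : ℝ)) ∉ Vm := by
    intro ρ _ hmem
    exact hlevel ρ (hVm_down ρ 1 (9 / 10) (by norm_num) hmem)
  have hstart : ((1 : ℝ), (0 : ℝ)) ∉ Vm := by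
    rintro ⟨n, hn, w, hw⟩
    have h := (hA n (le_trans hn₁₄ hn) w).2.2.1
    linarith
  have hfin_m : ((0 : ℝ), (1 / 2 : ℝ)) ∉ Vm := by
    rintro ⟨n, hn, w, hw⟩
    have h := (hA n (le_trans hn₁₄ hn) w).2.2.2.1
    linarith
  have hfin_p : ((0 : ℝ), (1 / 2 : ℝ)) ∉ Vp := by
    rintro ⟨n, hn, w, hw⟩
    have h := (hA n (le_trans hn₁₄ hn) w).2.2.2.2
    linarith
  -- (14) tying helps: `V⁻ ∩ {c ≤ c₀'}` is a down-set in `ρ`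
  have hflowT : ∀ ρ₁ ρ₂ c : ℝ, 0 ≤ ρ₁ → ρ₁ ≤ ρ₂ → ρ₂ ≤ 1 → c ≤ c₀' → (ρ₂, c) ∈ Vm → (ρ₁, c) ∈ Vm := by
    rintro ρ₁ ρ₂ c - h12 - hc ⟨n, hn, w, hw⟩
    exact ⟨n, hn, w, lt_of_le_of_lt (hT n (le_trans hn₁₁ hn) w c (le_trans hc hc₀'le) ρ₁ ρ₂ h12) hw⟩
  -- (15) the cone flow: `V⁻` is invariant under `(ρ,c) ↦ (ρ', c − L|ρ−ρ'|)` above `c_lo`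
  have hflowL : ∀ ρ ρ' c : ℝ, ρ ∈ Icc (0 : ℝ) 1 → ρ' ∈ Icc (0 : ℝ) 1 → (ρ, c) ∈ Vm →
      c₀' / 2 ≤ c - L * |ρ - ρ'| → (ρ', c - L * |ρ - ρ'|) ∈ Vm := by
    rintro ρ ρ' c - - hmem hlo
    obtain ⟨n, hn, w, hw⟩ := hmem
    -- `c ≤ 9/10`, else `(ρ, 9/10) ∈ V⁻` by down-closedness, contradicting anchor (d)
    have hc9 : c ≤ 9 / 10 :=
      le_of_not_gt fun hcon => hlevel ρ (hVm_down ρ c (9 / 10) hcon.le ⟨n, hn, w, hw⟩)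
    have key := hC n (le_trans hn₁₂ hn) w ρ' ρ (c - L * |ρ - ρ'|) hlo
      (by rw [abs_sub_comm ρ' ρ]; linarith)
    have heq : c - L * |ρ - ρ'| + L * |ρ' - ρ| = c := by rw [abs_sub_comm ρ' ρ]; ring
    rw [heq] at key
    exact ⟨n, hn, w, lt_of_le_of_lt key hw⟩
  -- the envelope path
  obtain ⟨γ, hγc, hγ0, hγ1, hγI, hγbv1, hγbv2, hγK⟩ :=
    h6 Vm Vp c₀' (c₀' / 2) L hVm_open hVp_open hVm_down hVp_up hdisj hbot htop hstart hfin_m hfin_p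
      hclo (by linarith) hL hflowT hflowL
  refine ⟨γ, hγc, hγ0, hγ1, hγI, hγbv1, hγbv2, ?_⟩
  -- uniform box-crossing bounds on the certificate set
  intro a ha
  obtain ⟨c₁, hc₁, n₀, hB⟩ := h5 k hk ε₀ hε₀ n₁ a ha
  exact ⟨c₁, hc₁, n₀, fun s => hB (γ s) ⟨hγI s, fun n hn w =>
    ⟨le_of_not_gt fun hcon => (hγK s).1 ⟨n, hn, w, hcon⟩,
     le_of_not_gt fun hcon => (hγK s).2 ⟨n, hn, w, hcon⟩⟩⟩⟩

/-- Wiring check: the registered stubs feed `CriticalPathRSW_of` as stated (the verbatim restatements are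
definitionally the named statements). -/
example : Summit.CriticalPhenomena.CardyFormulaZ2.Theses.CardySelfRefinement.CriticalPathRSW :=
  CriticalPathRSW_of stub_tyingHelps stub_interiorPrices stub_finiteSizeCriterion stub_phaseDiagramAnchors
    stub_squareBoundsGiveRSW stub_envelopePath

end Summit.CriticalPhenomena.CardyFormulaZ2.Cruxes.CriticalPathRSW.TyingHelpsParity

end
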